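import Mathlib
import HarnessLib
import Summits.HubbardSuperconductivity.HubbardSuperconductivity.Theorems.KLProgrammeKLRegimeEngineTowerLipschitz
import Summits.HubbardSuperconductivity.HubbardSuperconductivity.Theorems.KLProgrammeKLRegimeEngineTowerTwoLegIncrement
import Summits.HubbardSuperconductivity.HubbardSuperconductivity.Theorems.KLProgrammeKLRegimeEngineTowerQuarticIncrement

/-!
# Route `KLProgramme` — crux K3 ENGINE (stmt-HubbardSuperconductivity-20437 `KLRegimeEngineV17F2`), stub (b): the blocked-tower bookkeeping,
# part 11b — the LIPSCHITZ form at the LOW output degrees: the two-leg and the quartic DIFFERENCE increments of a block step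
# (E1 lead r2d-p2 g7; (R59)/(R59i) located risk «(e)-C-RATE»: rows C1/C2 of stub (e) read the TWO-LEG local-part differences)

Part 11 (`towerBornDiff_le_law₄`) closes the difference tower in the recursive degrees `2p ≥ 6`.  What the (e) lane's rows C1/C2 (`TwoLegVolumeRateF … n`
and the two-cutoff twin) and the value lane's two-volume rows actually READ is the difference of the LOW-degree outputs of a block step — two legs (the
local part `δν`) and four legs — exactly as class #7 / (E4)ₙ read the one-volume increments of parts 10 / 6 (`towerTwoLegIncrement_le`,
`towerQuarticIncrement_le`).  Same honest bookkeeping as there, in Lipschitz form: EVERY input of the step is `O(λ)` — the common majorant `μ m ≤ λ·ν m`,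
the measured DIFFERENCES `dμ m ≤ λ·νd m` on `[1, D]` (Chernoff sums `Σ τ^δ ν δ ≤ G′`, `Σ τ^δ νd δ ≤ Gd`; in the relative setting of part 11 `νd = R k·ν`,
`Gd = R k·G′`, `Ad′ = R k·A′`) — so the order-`n` telescoped graded term (`towerSLip`, one slot the difference, `n − 1` slots the majorant) carries
`n·λⁿ·Gd·G′^{n−1}`, and the first order is LINEAR in the difference data:

* `sum_Icc_mul_pow_sub_two_le` — `Σ_{n∈[2,N]} n y^{n−2} ≤ (2 − y)/(1 − y)²` (`0 ≤ y < 1`);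
* `sum_pow_mul_le_mul_of_le_mul` — `μ ≤ λ·ν` on `[1,D]` ⇒ `Σ τ^δ μ δ ≤ λ·Σ τ^δ ν δ`;
* **`towerLipStep_le_of_linear`** — the Lipschitz step with all inputs `O(λ)`, any output degree `p`, first order bounded by `F`:
  `db ≤ F + λ²·e·ψ^p·Φ·Gd·G′·(2 − y)/(1 − y)² + src`, `y = ΦλG′`;
* **`towerTwoLegDiffIncrement_le`** (`p = 1`) — `db ≤ λ·(6σ·νd 2 + 16·Ad′σQ′²/(1 − x₁)) + λ²·e·ψ·Φ·Gd·G′·(2 − y)/(1 − y)² + src`;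
* **`towerQuarticDiffIncrement_le`** (`p = 2`) — `db ≤ λ²·(64·Ad′σQ′³/(1 − x₁) + e·ψ²·Φ·Gd·G′·(2 − y)/(1 − y)²) + src`.
With `νd = R·ν`, `Gd = R·G′`, `Ad′ = R·A′` these are `R ×` (parts 10 / 6 with `1/(1−y) ↦ (2−y)/(1−y)²`) `+ src`: the two-leg / quartic born DIFFERENCE of a
block step is the budget `R k` of part 11 times the one-volume increment law, plus the step's own volume/cutoff source — `n`-free, no `λ`-free smallness.
Pure real analysis; nothing about the model is asserted.  NOT here: as in part 11 (G1-Lip, sources, transfer map, read-out are other lanes').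
-/

noncomputable section

namespace Summit.HubbardSuperconductivity.HubbardSuperconductivity.Theorems.EngineV8

set_option linter.dupNamespace false -- summit = problem name (single-conjunct summit), D-0017

open Real Finset

/-! ## §1 Two elementary sums -/

/-- `Σ_{n ∈ [2, N]} n·y^{n−2} ≤ (2 − y)/(1 − y)²` for `0 ≤ y < 1` (`= Σ_{j ≥ 0} (j+2) y^j = y/(1−y)² + 2/(1−y)`). -/
theorem sum_Icc_mul_pow_sub_two_le {y : ℝ} (hy0 : 0 ≤ y) (hy1 : y < 1) (N : ℕ) :
    ∑ n ∈ Icc 2 N, (n : ℝ) * y ^ (n - 2) ≤ (2 - y) / (1 - y) ^ 2 := by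
  have hy1' : 0 < 1 - y := sub_pos.2 hy1
  have hnorm : ‖y‖ < 1 := by rw [Real.norm_eq_abs, abs_of_nonneg hy0]; exact hy1
  have h1 : HasSum (fun j : ℕ => (j : ℝ) * y ^ j) (y / (1 - y) ^ 2) := hasSum_coe_mul_geometric_of_norm_lt_one hnorm
  have h2 : HasSum (fun j : ℕ => y ^ j) (1 - y)⁻¹ := hasSum_geometric_of_lt_one hy0 hy1
  have h3 : HasSum (fun j : ℕ => ((j : ℝ) + 2) * y ^ j) (y / (1 - y) ^ 2 + 2 * (1 - y)⁻¹) := by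
    convert h1.add (h2.mul_left 2) using 1; ext j; ring
  have hval : y / (1 - y) ^ 2 + 2 * (1 - y)⁻¹ = (2 - y) / (1 - y) ^ 2 := by field_simp; ring
  rw [hval] at h3
  have hre : ∑ n ∈ Icc 2 N, (n : ℝ) * y ^ (n - 2) = ∑ j ∈ range (N - 1), ((j : ℝ) + 2) * y ^ j := by
    rcases Nat.lt_or_ge N 2 with hN | hN
    · rw [Icc_eq_empty (by omega), show N - 1 = 0 by omega, sum_empty, range_zero, sum_empty]
    · have hI : Icc 2 N = (range (N - 1)).map (addRightEmbedding 2) := by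
        rw [range_eq_Ico, map_add_right_Ico]; ext m; simp only [mem_Icc, mem_Ico]; omega
      rw [hI, sum_map]
      refine sum_congr rfl fun j _ => ?_
      simp only [addRightEmbedding_apply, Nat.add_sub_cancel, Nat.cast_add, Nat.cast_ofNat]
  rw [hre]
  exact h3.summable.sum_le_tsum _ (fun j _ => by positivity) |>.trans (le_of_eq h3.tsum_eq)

/-- `μ m ≤ λ·ν m` on `[1, D]` (`0 ≤ τ`) ⇒ `Σ_{δ∈[1,D]} τ^δ μ δ ≤ λ · Σ_{δ∈[1,D]} τ^δ ν δ`. -/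
theorem sum_pow_mul_le_mul_of_le_mul {D : ℕ} {τ lam : ℝ} {μ ν : ℕ → ℝ} (hτ : 0 ≤ τ)
    (hμν : ∀ m, 1 ≤ m → m ≤ D → μ m ≤ lam * ν m) :
    ∑ δ ∈ Icc 1 D, τ ^ δ * μ δ ≤ lam * ∑ δ ∈ Icc 1 D, τ ^ δ * ν δ := by
  rw [mul_sum]
  refine sum_le_sum fun δ hδ => ?_
  calc τ ^ δ * μ δ ≤ τ ^ δ * (lam * ν δ) :=
        mul_le_mul_of_nonneg_left (hμν δ (mem_Icc.1 hδ).1 (mem_Icc.1 hδ).2) (pow_nonneg hτ _)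
    _ = lam * (τ ^ δ * ν δ) := by ring

/-! ## §2 The Lipschitz step with all inputs `O(λ)` -/

/-- **The Lipschitz block step when every input is `O(λ)`** (any output degree `p`; the low-degree core).  Majorant `0 ≤ μ ≤ λ·ν`, differences
`0 ≤ dμ ≤ λ·νd` on `[1, D]` (`0 ≤ ν, νd`), Chernoff sums `Σ τ^δ ν δ ≤ G′`, `Σ τ^δ νd δ ≤ Gd`, a first-order bound `towerFO D σ dμ p ≤ F`, smallness
`y = ΦλG′ < 1`, `towerV D τ μ ≤ V̄`, `ΦV̄ < 1`, and the suppliers' LIPSCHITZ step hypothesis (∀ N ≥ 2, guard `ΦV < 1`; telescoped graded orders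
`towerSLip`, `Ct` tails of the majorant, source `src`).  Then `db ≤ F + λ²·e·ψ^p·Φ·Gd·G′·(2 − y)/(1 − y)² + src` — order `n` carries
`n·λⁿ·Gd·G′^{n−1}`, and `Σ_{n≥2} n y^{n−2} = (2−y)/(1−y)²`. -/
theorem towerLipStep_le_of_linear {D : ℕ} {dμ μ νd ν : ℕ → ℝ} {db σ Φ ψ τ lam F Gd G' Vb Ct src : ℝ} (p : ℕ)
    (hΦ : 0 ≤ Φ) (hψ : 0 ≤ ψ) (hτ : 0 ≤ τ) (hlam : 0 ≤ lam) (hCt : 0 ≤ Ct)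
    (hdμ0 : ∀ m, 0 ≤ dμ m) (hμ0 : ∀ m, 0 ≤ μ m) (hνd0 : ∀ m, 0 ≤ νd m) (hν0 : ∀ m, 0 ≤ ν m)
    (hdμν : ∀ m, 1 ≤ m → m ≤ D → dμ m ≤ lam * νd m) (hμν : ∀ m, 1 ≤ m → m ≤ D → μ m ≤ lam * ν m)
    (hGd : ∑ δ ∈ Icc 1 D, τ ^ δ * νd δ ≤ Gd) (hG' : ∑ δ ∈ Icc 1 D, τ ^ δ * ν δ ≤ G') (hFp : towerFO D σ dμ p ≤ F)
    (hy : Φ * lam * G' < 1) (hVb : towerV D τ μ ≤ Vb) (hθ : Φ * Vb < 1)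
    (hstep : ∀ N : ℕ, 2 ≤ N → Φ * towerV D τ μ < 1 →
      db ≤ towerFO D σ dμ p + ∑ n ∈ Icc 2 N, exp 1 * Φ ^ (n - 1) * ψ ^ p * towerSLip D τ dμ μ n p +
        Ct * (ψ ^ p * exp 1 * towerV D τ μ * (Φ * towerV D τ μ) ^ N / (1 - Φ * towerV D τ μ)) + src) :
    db ≤ F + lam ^ 2 * (exp 1 * ψ ^ p * Φ * Gd * G' * ((2 - Φ * lam * G') / (1 - Φ * lam * G') ^ 2)) + src := by
  set V := towerV D τ μ with hVdef
  have hV0 : 0 ≤ V := towerV_nonneg hτ hμ0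
  have hθ0 : 0 ≤ Φ * V := mul_nonneg hΦ hV0
  have hθle : Φ * V ≤ Φ * Vb := mul_le_mul_of_nonneg_left hVb hΦ
  have hθ1 : Φ * V < 1 := hθle.trans_lt hθ
  have hθb0 : 0 ≤ Φ * Vb := hθ0.trans hθle
  have hVb0 : 0 ≤ Vb := hV0.trans hVb
  have hSd0 : 0 ≤ ∑ δ ∈ Icc 1 D, τ ^ δ * νd δ := sum_nonneg fun δ _ => by have := hνd0 δ; positivity
  have hS0 : 0 ≤ ∑ δ ∈ Icc 1 D, τ ^ δ * ν δ := sum_nonneg fun δ _ => by have := hν0 δ; positivity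
  have hGd0 : 0 ≤ Gd := hSd0.trans hGd
  have hG'0 : 0 ≤ G' := hS0.trans hG'
  have hy0 : 0 ≤ Φ * lam * G' := by positivity
  -- the Chernoff sums of the data at `w = 1`
  have hCd : ∑ δ ∈ Icc 1 D, τ ^ δ * dμ δ ≤ lam * Gd :=
    (sum_pow_mul_le_mul_of_le_mul hτ hdμν).trans (mul_le_mul_of_nonneg_left hGd hlam)
  have hC : ∑ δ ∈ Icc 1 D, τ ^ δ * μ δ ≤ lam * G' :=
    (sum_pow_mul_le_mul_of_le_mul hτ hμν).trans (mul_le_mul_of_nonneg_left hG' hlam)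
  have hCd0 : 0 ≤ ∑ δ ∈ Icc 1 D, τ ^ δ * dμ δ := sum_nonneg fun δ _ => by have := hdμ0 δ; positivity
  have hC0 : 0 ≤ ∑ δ ∈ Icc 1 D, τ ^ δ * μ δ := sum_nonneg fun δ _ => by have := hμ0 δ; positivity
  set M := exp 1 * ψ ^ p * Φ * lam ^ 2 * Gd * G' with hM
  have hM0 : 0 ≤ M := by positivity
  set Z := (2 - Φ * lam * G') / (1 - Φ * lam * G') ^ 2 with hZ
  set T : ℕ → ℝ := fun N => Ct * (ψ ^ p * exp 1 * Vb * (Φ * Vb) ^ N / (1 - Φ * Vb)) with hT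
  have hGr : ∀ N, ∑ n ∈ Icc 2 N, exp 1 * Φ ^ (n - 1) * ψ ^ p * towerSLip D τ dμ μ n p ≤ M * Z := by
    intro N
    have hterm : ∀ n ∈ Icc 2 N, exp 1 * Φ ^ (n - 1) * ψ ^ p * towerSLip D τ dμ μ n p ≤ M * ((n : ℝ) * (Φ * lam * G') ^ (n - 2)) := by
      intro n hn
      have hn2 : 2 ≤ n := (mem_Icc.1 hn).1
      have hS := towerSLip_le_chernoff (D := D) hτ hdμ0 hμ0 le_rfl n p
      simp only [one_pow, inv_one, one_mul, mul_one] at hS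
      have hS' : towerSLip D τ dμ μ n p ≤ n * ((lam * Gd) * (lam * G') ^ (n - 1)) := by
        refine hS.trans ?_
        have hpow : (∑ δ ∈ Icc 1 D, τ ^ δ * μ δ) ^ (n - 1) ≤ (lam * G') ^ (n - 1) := pow_le_pow_left₀ hC0 hC _
        gcongr
      calc exp 1 * Φ ^ (n - 1) * ψ ^ p * towerSLip D τ dμ μ n p
          ≤ exp 1 * Φ ^ (n - 1) * ψ ^ p * (n * ((lam * Gd) * (lam * G') ^ (n - 1))) := by
            have := towerSLip_nonneg hτ hdμ0 hμ0 n p (D := D); gcongr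
        _ = M * ((n : ℝ) * (Φ * lam * G') ^ (n - 2)) := by
            rw [hM]
            obtain ⟨j, rfl⟩ : ∃ j, n = j + 2 := ⟨n - 2, by omega⟩
            rw [show j + 2 - 1 = j + 1 by omega, Nat.add_sub_cancel]
            simp only [pow_succ, mul_pow]
            ring
    refine (sum_le_sum hterm).trans ?_
    rw [← mul_sum]
    exact mul_le_mul_of_nonneg_left (sum_Icc_mul_pow_sub_two_le hy0 hy N) hM0
  have hTail : ∀ N, Ct * (ψ ^ p * exp 1 * V * (Φ * V) ^ N / (1 - Φ * V)) ≤ T N := by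
    intro N
    have h1 : 0 < 1 - Φ * Vb := sub_pos.2 hθ
    have h2 : 1 - Φ * Vb ≤ 1 - Φ * V := by linarith
    rw [hT]; dsimp only; refine mul_le_mul_of_nonneg_left ?_ hCt
    rw [div_eq_mul_inv, div_eq_mul_inv]
    have hinv : (1 - Φ * V)⁻¹ ≤ (1 - Φ * Vb)⁻¹ := inv_anti₀ h1 h2
    have hpowN : (Φ * V) ^ N ≤ (Φ * Vb) ^ N := pow_le_pow_left₀ hθ0 hθle N
    have : 0 ≤ (1 - Φ * V)⁻¹ := inv_nonneg.2 (sub_nonneg.2 hθ1.le)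
    gcongr
  have hbN : ∀ N, 2 ≤ N → db ≤ F + M * Z + T N + src := fun N hN =>
    (hstep N hN hθ1).trans (by linarith [hFp, hGr N, hTail N])
  have hTto : Filter.Tendsto T Filter.atTop (nhds 0) := by
    have h := ((tendsto_pow_atTop_nhds_zero_of_lt_one hθb0 hθ).mul_const ((1 - Φ * Vb)⁻¹)).const_mul (Ct * (ψ ^ p * exp 1 * Vb))
    rw [zero_mul, mul_zero] at h
    refine h.congr' (Filter.Eventually.of_forall fun N => ?_)
    rw [hT]; dsimp only; rw [div_eq_mul_inv]; ring
  have hlim : Filter.Tendsto (fun N => F + M * Z + T N + src) Filter.atTop (nhds (F + M * Z + 0 + src)) :=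
    ((hTto.const_add (F + M * Z)).add_const src)
  have := ge_of_tendsto hlim (Filter.eventually_atTop.2 ⟨2, fun N hN => hbN N hN⟩)
  rw [add_zero, hM] at this
  refine this.trans (le_of_eq ?_)
  ring

/-! ## §3 The two-leg and the quartic difference increments -/

/-- **The two-leg DIFFERENCE increment of a block step** (Lipschitz twin of `towerTwoLegIncrement_le`, part 10).  Majorant `μ ≤ λ·ν`, differences
`dμ ≤ λ·νd` on `[1, D]` with `Σ τ^δ ν δ ≤ G′`, `Σ τ^δ νd δ ≤ Gd`, the difference's recursive profile `dμ m ≤ Ad′λ^{m−1}Q′^m` in degrees `2m ≥ 6` (for the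
first order), `x₁ = 4σλQ′ < 1`, `y = ΦλG′ < 1`, `towerV D τ μ ≤ V̄`, `ΦV̄ < 1`, and the Lipschitz step hypothesis at `p = 1`.  Then
`db ≤ λ·(6σ·νd 2 + 16·Ad′σQ′²/(1 − x₁)) + λ²·e·ψ·Φ·Gd·G′·(2 − y)/(1 − y)² + src`.  With `νd = R·ν`, `Gd = R·G′`, `Ad′ = R·A′` (part 11's budget) this is
`R ×` part 10's law (with `1/(1−y) ↦ (2−y)/(1−y)²`) `+ src` — what rows C1/C2 of stub (e) read at the block boundaries. -/
theorem towerTwoLegDiffIncrement_le {D : ℕ} {dμ μ νd ν : ℕ → ℝ} {db σ Φ ψ τ lam Ad' Q' Gd G' Vb Ct src : ℝ}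
    (hσ : 0 ≤ σ) (hΦ : 0 ≤ Φ) (hψ : 0 ≤ ψ) (hτ : 0 ≤ τ) (hlam : 0 ≤ lam) (hAd' : 0 ≤ Ad') (hQ' : 0 ≤ Q') (hCt : 0 ≤ Ct)
    (hdμ0 : ∀ m, 0 ≤ dμ m) (hμ0 : ∀ m, 0 ≤ μ m) (hνd0 : ∀ m, 0 ≤ νd m) (hν0 : ∀ m, 0 ≤ ν m)
    (hdμν : ∀ m, 1 ≤ m → m ≤ D → dμ m ≤ lam * νd m) (hμν : ∀ m, 1 ≤ m → m ≤ D → μ m ≤ lam * ν m)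
    (hGd : ∑ δ ∈ Icc 1 D, τ ^ δ * νd δ ≤ Gd) (hG' : ∑ δ ∈ Icc 1 D, τ ^ δ * ν δ ≤ G')
    (hdprof : ∀ m, 3 ≤ m → m ≤ D → dμ m ≤ Ad' * lam ^ (m - 1) * Q' ^ m)
    (hx₁ : 4 * σ * lam * Q' < 1) (hy : Φ * lam * G' < 1) (hVb : towerV D τ μ ≤ Vb) (hθ : Φ * Vb < 1)
    (hstep : ∀ N : ℕ, 2 ≤ N → Φ * towerV D τ μ < 1 →
      db ≤ towerFO D σ dμ 1 + ∑ n ∈ Icc 2 N, exp 1 * Φ ^ (n - 1) * ψ ^ 1 * towerSLip D τ dμ μ n 1 +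
        Ct * (ψ ^ 1 * exp 1 * towerV D τ μ * (Φ * towerV D τ μ) ^ N / (1 - Φ * towerV D τ μ)) + src) :
    db ≤ lam * (6 * σ * νd 2 + 16 * Ad' * σ * Q' ^ 2 / (1 - 4 * σ * lam * Q')) +
      lam ^ 2 * (exp 1 * ψ * Φ * Gd * G' * ((2 - Φ * lam * G') / (1 - Φ * lam * G') ^ 2)) + src := by
  have hFO := towerFO_one_le hσ hAd' hlam hQ' hdμ0 hνd0 hdμν hdprof hx₁ (D := D)
  have h := towerLipStep_le_of_linear 1 hΦ hψ hτ hlam hCt hdμ0 hμ0 hνd0 hν0 hdμν hμν hGd hG' hFO hy hVb hθ hstep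
  rwa [pow_one] at h

/-- **The quartic DIFFERENCE increment of a block step** (Lipschitz twin of `towerQuarticIncrement_le`, part 6).  Same data as
`towerTwoLegDiffIncrement_le`, Lipschitz step hypothesis at `p = 2`.  Then `db ≤ λ²·(64·Ad′σQ′³/(1 − x₁) + e·ψ²·Φ·Gd·G′·(2 − y)/(1 − y)²) + src` — the
first order from the self-contractions of the difference's `2m ≥ 6` kernels (`λ^{m−1} ≤ λ²`), order `n` at `n·λⁿ`; what the value lane's two-volume rows
(and the two-cutoff twin) read. -/
theorem towerQuarticDiffIncrement_le {D : ℕ} {dμ μ νd ν : ℕ → ℝ} {db σ Φ ψ τ lam Ad' Q' Gd G' Vb Ct src : ℝ}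
    (hσ : 0 ≤ σ) (hΦ : 0 ≤ Φ) (hψ : 0 ≤ ψ) (hτ : 0 ≤ τ) (hlam : 0 ≤ lam) (hAd' : 0 ≤ Ad') (hQ' : 0 ≤ Q') (hCt : 0 ≤ Ct)
    (hdμ0 : ∀ m, 0 ≤ dμ m) (hμ0 : ∀ m, 0 ≤ μ m) (hνd0 : ∀ m, 0 ≤ νd m) (hν0 : ∀ m, 0 ≤ ν m)
    (hdμν : ∀ m, 1 ≤ m → m ≤ D → dμ m ≤ lam * νd m) (hμν : ∀ m, 1 ≤ m → m ≤ D → μ m ≤ lam * ν m)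
    (hGd : ∑ δ ∈ Icc 1 D, τ ^ δ * νd δ ≤ Gd) (hG' : ∑ δ ∈ Icc 1 D, τ ^ δ * ν δ ≤ G')
    (hdprof : ∀ m, 3 ≤ m → m ≤ D → dμ m ≤ Ad' * lam ^ (m - 1) * Q' ^ m)
    (hx₁ : 4 * σ * lam * Q' < 1) (hy : Φ * lam * G' < 1) (hVb : towerV D τ μ ≤ Vb) (hθ : Φ * Vb < 1)
    (hstep : ∀ N : ℕ, 2 ≤ N → Φ * towerV D τ μ < 1 →
      db ≤ towerFO D σ dμ 2 + ∑ n ∈ Icc 2 N, exp 1 * Φ ^ (n - 1) * ψ ^ 2 * towerSLip D τ dμ μ n 2 +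
        Ct * (ψ ^ 2 * exp 1 * towerV D τ μ * (Φ * towerV D τ μ) ^ N / (1 - Φ * towerV D τ μ)) + src) :
    db ≤ lam ^ 2 * (64 * Ad' * σ * Q' ^ 3 / (1 - 4 * σ * lam * Q') +
      exp 1 * ψ ^ 2 * Φ * Gd * G' * ((2 - Φ * lam * G') / (1 - Φ * lam * G') ^ 2)) + src := by
  have hFO := towerFO_two_le hσ hAd' hlam hQ' hdμ0 hdprof hx₁ (D := D)
  have h := towerLipStep_le_of_linear 2 hΦ hψ hτ hlam hCt hdμ0 hμ0 hνd0 hν0 hdμν hμν hGd hG' hFO hy hVb hθ hstep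
  refine h.trans (le_of_eq ?_)
  ring

end Summit.HubbardSuperconductivity.HubbardSuperconductivity.Theorems.EngineV8

end
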